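import Summits.HubbardSuperconductivity.HubbardSuperconductivity.Theses.GibbsMajorant
import Summits.HubbardSuperconductivity.HubbardSuperconductivity.Theorems.BalabanIRBirEveryGroundStateSectorPB
import Summits.HubbardSuperconductivity.HubbardSuperconductivity.Theorems.BalabanIRBirGroundStateAverageLROSectorCompression
import Summits.HubbardSuperconductivity.HubbardSuperconductivity.Cruxes.WindowGap.SketchStrategistS1
import Literature.Barriers.HubbardSuperconductivity.PureModelStripeCompetitionProofs
import Literature.MathematicalPhysics.QuantumLattice.GibbsLinearResponse

/-!
# Crux `ThermalWindowMajorant` (stmt-HubbardSuperconductivity-15716) — redirect strategist r1, TYPED companion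

Companion of `Cruxes/ThermalWindowMajorant/STRATEGY-CENSUS.md` (seat
planner-cstrat-stmt-HubbardSuperconductivity-15716-r1-0, 2026-08-17). No `sorry`; nothing here is a line.

KERNEL-CHECKED "COSTUME" THEOREMS. Write the crux as `∃ (U,δ,θ,ε₁) ∀ ε ∃ β ∃ L₀ ∀ L ∃ a ≥ 0, TwmBody U δ θ ε β L a`
(`twm_iff`, `Iff.rfl`). By the route's own lever (spectral Jensen / the Gibbs weight majorises every eigenvector),
the body at one datum forces, with the SAME `a` (which is therefore `> 0`):

* `GroundFloorAt`  — every normalised sector ground state has `θL² + log 2 / a ≤ Re⟨ψ, W_ε ψ⟩`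
  (the content of the route's supports `MajorantTransfer` / `FloorOfCruxes`, with the better constant `θ` for `θ/2`);
* `EigenChernoffAt` — every normalised sector EIGENVECTOR `Hφ = Eφ` obeys `log 2 ≤ β(E − E₀) + a(Re⟨φ,W_εφ⟩ − θL²)`:
  window-poor eigenstates lie above the ground energy by `≥ (aθL² − a⟨W⟩ + log 2)/β` — the per-eigenstate form of
  KacWindowPenalty's `WindowGap` (stmt-1088; eread DOMINANCE.md has the every-vector form via Golden–Thompson);
* `ThermalFloorAt` — the sector Gibbs state at the FIXED `β(ε)` has Kac-window pair weight
  `⟨W_ε⟩_{β,K} ≥ θL² + (log 2 + log(Z_K e^{βE₀}))/a > θL²`: positive-temperature `d`-wave window quasi-order of the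
  2D Hubbard torus, with the configurational entropy `log(Z_K e^{βE₀}) ≥ 0` as an ADDITIONAL debit (refuter ATTACK (ii)).

Globally: `everyGSWindowFloor_of_twm`, `thermalWindowQuasiOrder_of_twm`, and — joining the sibling census
(`Cruxes/WindowGap/SketchStrategistS1.lean`) — `windowFloor_of_twm : ThermalWindowMajorant → WindowFloor`,
`hubbardSuperconductivity_of_twm_of_wib : ThermalWindowMajorant → WindowInfraredBound → HubbardSuperconductivity`
(the route's deciding theorem WITHOUT its open supports `FloorOfCruxes` / `MajorantTransfer`), and
`floorAt_of_twm_point` + `StrategistS1.floorAt_iff_summitMatrix_of_wibAt`: GIVEN crux 3 at the point, what the route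
consumes of this crux IS the summit's matrix at `(U, δ)`. So inside the route's own cone
`ThermalWindowMajorant = (summit at the point) ∧ (thermal Kac-window quasi-order at fixed T) ∧ (eigenstate window gap)`,
the last two conjuncts being extra open obligations with no engine (census §Transfer).
-/

set_option linter.dupNamespace false

noncomputable section

namespace Summit.HubbardSuperconductivity.HubbardSuperconductivity.Cruxes.ThermalWindowMajorant.StrategistR1

open Matrix Finset Literature.MathematicalPhysics.QuantumLattice
open scoped ComplexOrder
open Summit.HubbardSuperconductivity.HubbardSuperconductivity.Theses.GibbsMajorant
  (ThermalWindowMajorant WindowInfraredBound)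
open Summit.HubbardSuperconductivity.HubbardSuperconductivity.Theorems
open Summit.HubbardSuperconductivity.HubbardSuperconductivity.Theorems.BirGroundStateAverageLRO.Softmin
  (gibbsWeight_mulVec_of_eigenvector)
open Summit.HubbardSuperconductivity.HubbardSuperconductivity.Cruxes.WindowGap.StrategistS1
  (Nfill kacW FloorAt WibAt WindowFloor hubbardSuperconductivity_of_windowFloor_of_wib
    floorAt_iff_summitMatrix_of_wibAt)
open Literature.Barriers.HubbardSuperconductivity (exists_unit_isGroundStateInSector_hubbardTorus
  natFloor_filling_le_sq)

/-! ## Abstract finite-dimensional core: the majorant only climbs -/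

section Abstract

variable {n : Type*} [Fintype n] [DecidableEq n]

/-- **Eigenvector Chernoff lower bound.** `H`, `W` Hermitian, `P` a Hermitian matrix with `Pφ = φ` for a unit
eigenvector `Hφ = Eφ`, real `β`, `a`. Then `e^{-βE} e^{-a Re⟨φ,Wφ⟩} ≤ Re tr(e^{-βH} · P e^{-aW} P)`:
`tr(e^{-βH}X) = tr(e^{-βH/2} X e^{-βH/2}) ≥ ⟨φ, e^{-βH/2} X e^{-βH/2} φ⟩ = e^{-βE}⟨φ, e^{-aW} φ⟩ ≥ e^{-βE} e^{-a⟨φ,Wφ⟩}`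
(positivity of `X = P e^{-aW} P`, spectral Jensen). [folklore] -/
theorem exp_mul_exp_le_re_trace_gibbs_sandwich {H W P : Matrix n n ℂ} (hH : H.IsHermitian)
    (hW : W.IsHermitian) (hP : P.IsHermitian) {φ : n → ℂ} (hφ : star φ ⬝ᵥ φ = 1) (hPφ : P *ᵥ φ = φ)
    {E : ℝ} (hHφ : H *ᵥ φ = ((E : ℝ) : ℂ) • φ) (β a : ℝ) :
    Real.exp (-(β * E)) * Real.exp (-(a * (star φ ⬝ᵥ W *ᵥ φ).re)) ≤
      (gibbsWeight β H * (P * gibbsWeight a W * P)).trace.re := by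
  set Gh : Matrix n n ℂ := gibbsWeight (β / 2) H with hGhdef
  set Y : Matrix n n ℂ := gibbsWeight a W with hYdef
  have hGh : Gh.IsHermitian := isHermitian_gibbsWeight (β / 2) hH
  have hY : Y.PosSemidef := (posDef_gibbsWeight a hW).posSemidef
  have hGG : Gh * Gh = gibbsWeight β H := by
    rw [hGhdef, Matrix.gibbsWeight_mul_gibbsWeight, add_halves]
  -- positivity of the sandwich and of its symmetric Gibbs conjugate
  have hX : (P * Y * P).PosSemidef := by
    have h := hY.mul_mul_conjTranspose_same P
    rwa [hP.eq] at h
  have hB : (Gh * (P * Y * P) * Gh).PosSemidef := by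
    have h := hX.mul_mul_conjTranspose_same Gh
    rwa [hGh.eq] at h
  -- the trace as a symmetric conjugate
  have htr : (gibbsWeight β H * (P * Y * P)).trace = (Gh * (P * Y * P) * Gh).trace := by
    rw [← hGG, Matrix.mul_assoc, Matrix.trace_mul_comm]
  -- Rayleigh quotient of the unit vector `φ`
  have h1 : (star φ ⬝ᵥ (Gh * (P * Y * P) * Gh) *ᵥ φ).re ≤ (Gh * (P * Y * P) * Gh).trace.re :=
    re_rayleigh_le_re_trace_of_posSemidef hB hφ
  -- evaluate it: `Gh φ = c φ`, `c = e^{-βE/2}` real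
  set c : ℝ := Real.exp (-(β / 2 * E)) with hcdef
  have hGhφ : Gh *ᵥ φ = ((c : ℝ) : ℂ) • φ := gibbsWeight_mulVec_of_eigenvector hH hHφ (β / 2)
  have hφGh : star φ ᵥ* Gh = ((c : ℝ) : ℂ) • star φ := by
    rw [← hGh.eq, ← star_mulVec, hGhφ, star_smul, Complex.star_def, Complex.conj_ofReal]
  have hφP : star φ ᵥ* P = star φ := by
    rw [← hP.eq, ← star_mulVec, hPφ]
  have hquad : star φ ⬝ᵥ (Gh * (P * Y * P) * Gh) *ᵥ φ =
      ((c : ℝ) : ℂ) * ((c : ℝ) : ℂ) * (star φ ⬝ᵥ Y *ᵥ φ) := by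
    rw [← mulVec_mulVec, ← mulVec_mulVec, hGhφ, mulVec_smul, mulVec_smul, dotProduct_smul,
      dotProduct_mulVec, hφGh, smul_dotProduct, ← mulVec_mulVec, ← mulVec_mulVec, hPφ,
      dotProduct_mulVec, hφP, smul_eq_mul, smul_eq_mul, ← mul_assoc]
  have hcc : c * c = Real.exp (-(β * E)) := by
    rw [hcdef, ← Real.exp_add]; congr 1; ring
  have hre : (star φ ⬝ᵥ (Gh * (P * Y * P) * Gh) *ᵥ φ).re =
      Real.exp (-(β * E)) * (star φ ⬝ᵥ Y *ᵥ φ).re := by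
    rw [hquad, ← Complex.ofReal_mul, Complex.re_ofReal_mul, hcc]
  -- spectral Jensen for `e^{-aW}`
  have hJ : Real.exp (-(a * (star φ ⬝ᵥ W *ᵥ φ).re)) ≤ (star φ ⬝ᵥ Y *ᵥ φ).re :=
    exp_neg_mul_rayleigh_le_re_gibbsWeight hW a hφ
  calc Real.exp (-(β * E)) * Real.exp (-(a * (star φ ⬝ᵥ W *ᵥ φ).re))
      ≤ Real.exp (-(β * E)) * (star φ ⬝ᵥ Y *ᵥ φ).re :=
        mul_le_mul_of_nonneg_left hJ (Real.exp_pos _).le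
    _ = (star φ ⬝ᵥ (Gh * (P * Y * P) * Gh) *ᵥ φ).re := hre.symm
    _ ≤ (Gh * (P * Y * P) * Gh).trace.re := h1
    _ = (gibbsWeight β H * (P * Y * P)).trace.re := by rw [htr]

/-- **Eigenvector Chernoff inequality from the tilted bound.** If the ground-anchored tilted trace obeys
`e^{βE₀ + a c} · Re tr(e^{-βH} P e^{-aW} P) ≤ 1/2`, then every unit eigenvector `Hφ = Eφ` with `Pφ = φ` has
`log 2 ≤ β(E − E₀) + a(Re⟨φ,Wφ⟩ − c)`. [folklore] -/
theorem chernoff_of_tilted_bound {H W P : Matrix n n ℂ} (hH : H.IsHermitian) (hW : W.IsHermitian)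
    (hP : P.IsHermitian) {φ : n → ℂ} (hφ : star φ ⬝ᵥ φ = 1) (hPφ : P *ᵥ φ = φ) {E : ℝ}
    (hHφ : H *ᵥ φ = ((E : ℝ) : ℂ) • φ) {β a E₀ c : ℝ}
    (hb : Real.exp (β * E₀ + a * c) * (gibbsWeight β H * (P * gibbsWeight a W * P)).trace.re ≤ 1 / 2) :
    Real.log 2 ≤ β * (E - E₀) + a * ((star φ ⬝ᵥ W *ᵥ φ).re - c) := by
  have h1 := exp_mul_exp_le_re_trace_gibbs_sandwich hH hW hP hφ hPφ hHφ β a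
  set w : ℝ := (star φ ⬝ᵥ W *ᵥ φ).re with hw
  have h2 : Real.exp (β * E₀ + a * c) * (Real.exp (-(β * E)) * Real.exp (-(a * w))) ≤ 1 / 2 :=
    (mul_le_mul_of_nonneg_left h1 (Real.exp_pos _).le).trans hb
  rw [← Real.exp_add, ← Real.exp_add] at h2
  have h3 : β * E₀ + a * c + (-(β * E) + -(a * w)) ≤ Real.log (1 / 2) := by
    rw [Real.le_log_iff_exp_le (by norm_num : (0:ℝ) < 1 / 2)]
    exact h2
  have h4 : Real.log (1 / 2 : ℝ) = -Real.log 2 := by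
    rw [one_div, Real.log_inv]
  linarith

/-- Arithmetic of the ground case: `0 ≤ a`, `log 2 ≤ a(w − c)` force `a > 0` and `c + log 2 / a ≤ w` (so `c < w`).
[folklore] -/
theorem floor_of_chernoff {a c w : ℝ} (ha : 0 ≤ a) (h : Real.log 2 ≤ a * (w - c)) :
    0 < a ∧ c + Real.log 2 / a ≤ w ∧ c < w := by
  have hlog : 0 < Real.log 2 := Real.log_pos (by norm_num)
  have ha' : 0 < a := by
    rcases ha.eq_or_lt with h0 | h0
    · rw [← h0, zero_mul] at h
      linarith
    · exact h0
  have hwc : 0 < w - c := by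
    by_contra hneg
    have hle : w - c ≤ 0 := not_lt.mp hneg
    have : a * (w - c) ≤ 0 := by nlinarith
    linarith
  refine ⟨ha', ?_, by linarith⟩
  have : Real.log 2 / a ≤ w - c := by
    rw [div_le_iff₀ ha']
    linarith
  linarith

/-- **Mixed-state Jensen for the tilted sector trace.** `H`, `W` Hermitian, `P` a Hermitian idempotent, real
`β`, `a`, and `Z := Re tr(e^{-βH} P) > 0`. With `M := Re tr(e^{-βH} · P W P)` (so `M/Z = ⟨W⟩` in the `P`-compressed
Gibbs state): `Z · e^{-a M/Z} ≤ Re tr(e^{-βH} · P e^{-aW} P)`. Proof in an eigenbasis `u_j` of `H` with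
`w_j = P u_j`: the three traces are `Σ e^{-βλ_j}‖w_j‖²`, `Σ e^{-βλ_j}⟨w_j,Ww_j⟩`, `Σ e^{-βλ_j}⟨w_j,e^{-aW}w_j⟩`;
one-vector Jensen `⟨w,e^{-aW}w⟩ ≥ ‖w‖² e^{-a⟨w,Ww⟩/‖w‖²}` and Jensen for the Boltzmann weights. B. Simon,
*Statistical Mechanics of Lattice Gases* I §II.13 (Peierls–Bogoliubov pattern). [folklore] -/
theorem trace_mul_exp_le_re_trace_gibbs_sandwich {H W P : Matrix n n ℂ} (hH : H.IsHermitian)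
    (hW : W.IsHermitian) (hP : P.IsHermitian) (hPP : P * P = P) (β a : ℝ)
    (hZ : 0 < (gibbsWeight β H * P).trace.re) :
    (gibbsWeight β H * P).trace.re *
        Real.exp (-(a * ((gibbsWeight β H * (P * W * P)).trace.re / (gibbsWeight β H * P).trace.re))) ≤
      (gibbsWeight β H * (P * gibbsWeight a W * P)).trace.re := by
  have hPH : Pᴴ = P := hP.eq
  -- the eigenbasis of `H`
  set U : Matrix n n ℂ := (hH.eigenvectorUnitary : Matrix n n ℂ) with hU
  -- diagonal entries of conjugated matrices as quadratic forms of `w_j = P u_j`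
  have hdP : ∀ j, (star U * P * U) j j =
      star (P *ᵥ fun i => U i j) ⬝ᵥ (P *ᵥ fun i => U i j) := by
    intro j
    rw [star_mul_mul_apply_self, star_mulVec, ← dotProduct_mulVec, hPH, mulVec_mulVec, hPP]
  have hdA : ∀ (A : Matrix n n ℂ) (j : n), (star U * (P * A * P) * U) j j =
      star (P *ᵥ fun i => U i j) ⬝ᵥ A *ᵥ (P *ᵥ fun i => U i j) := by
    intro A j
    rw [star_mul_mul_apply_self, ← mulVec_mulVec, ← mulVec_mulVec, star_mulVec,
      ← dotProduct_mulVec, hPH]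
  -- abbreviations
  set ex : n → ℝ := fun j => Real.exp (-β * hH.eigenvalues j) with hex
  set c : n → ℝ := fun j => (star (P *ᵥ fun i => U i j) ⬝ᵥ (P *ᵥ fun i => U i j)).re with hc
  set t : n → ℝ := fun j => (star (P *ᵥ fun i => U i j) ⬝ᵥ W *ᵥ (P *ᵥ fun i => U i j)).re
    with ht
  set g : n → ℝ := fun j =>
    (star (P *ᵥ fun i => U i j) ⬝ᵥ gibbsWeight a W *ᵥ (P *ᵥ fun i => U i j)).re with hg
  -- the three traces as sums
  have hZs : (gibbsWeight β H * P).trace.re = ∑ j, ex j * c j := by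
    rw [trace_gibbsWeight_mul_eq_sum hH β P, Complex.re_sum]
    refine Finset.sum_congr rfl fun j _ => ?_
    rw [← hU, hdP, Complex.re_ofReal_mul]
  have hMs : (gibbsWeight β H * (P * W * P)).trace.re = ∑ j, ex j * t j := by
    rw [trace_gibbsWeight_mul_eq_sum hH β (P * W * P), Complex.re_sum]
    refine Finset.sum_congr rfl fun j _ => ?_
    rw [← hU, hdA W j, Complex.re_ofReal_mul]
  have hTs : (gibbsWeight β H * (P * gibbsWeight a W * P)).trace.re = ∑ j, ex j * g j := by
    rw [trace_gibbsWeight_mul_eq_sum hH β (P * gibbsWeight a W * P), Complex.re_sum]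
    refine Finset.sum_congr rfl fun j _ => ?_
    rw [← hU, hdA (gibbsWeight a W) j, Complex.re_ofReal_mul]
  -- elementary facts
  have hex0 : ∀ j, 0 < ex j := fun j => Real.exp_pos _
  have hzero : ∀ j, (P *ᵥ fun i => U i j) = 0 → c j = 0 ∧ t j = 0 ∧ g j = 0 := by
    intro j hv
    simp only [hc, ht, hg, hv, star_zero, zero_dotProduct, Complex.zero_re, and_self]
  have hcpos : ∀ j, (P *ᵥ fun i => U i j) ≠ 0 → 0 < c j := fun j hv =>
    (Complex.pos_iff.mp (dotProduct_star_self_pos_iff.2 hv)).1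
  have hc0 : ∀ j, 0 ≤ c j := by
    intro j
    by_cases hv : (P *ᵥ fun i => U i j) = 0
    · exact ((hzero j hv).1).symm.le
    · exact (hcpos j hv).le
  have hct : ∀ j, c j * (t j / c j) = t j := by
    intro j
    by_cases hv : (P *ᵥ fun i => U i j) = 0
    · rw [(hzero j hv).1, (hzero j hv).2.1, zero_mul]
    · exact mul_div_cancel₀ _ (hcpos j hv).ne'
  -- one-vector Jensen, term by term
  have hterm : ∀ j, ex j * c j * Real.exp (-(a * (t j / c j))) ≤ ex j * g j := by
    intro j
    by_cases hv : (P *ᵥ fun i => U i j) = 0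
    · rw [(hzero j hv).1, (hzero j hv).2.2, mul_zero, zero_mul]
    have key := re_dotProduct_self_mul_exp_le_re_gibbsWeight hW a hv
    have hcq : (star (P *ᵥ fun i => U i j) ⬝ᵥ (P *ᵥ fun i => U i j)).re = c j := rfl
    have htq : (star (P *ᵥ fun i => U i j) ⬝ᵥ W *ᵥ (P *ᵥ fun i => U i j)).re = t j := rfl
    rw [hcq, htq] at key
    calc ex j * c j * Real.exp (-(a * (t j / c j))) = ex j * (c j * Real.exp (-(a * (t j / c j)))) := by
          ring
      _ ≤ ex j * g j := mul_le_mul_of_nonneg_left key (hex0 j).le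
  rw [hZs, hMs, hTs]
  rw [hZs] at hZ
  set Z : ℝ := ∑ j, ex j * c j with hZdef
  -- Jensen for the Boltzmann weights `ex j * c j / Z`
  have hw0 : ∀ j ∈ (univ : Finset n), 0 ≤ ex j * c j / Z :=
    fun j _ => div_nonneg (mul_nonneg (hex0 j).le (hc0 j)) hZ.le
  have hw1 : ∑ j, ex j * c j / Z = 1 := by
    rw [← Finset.sum_div, div_self hZ.ne']
  have hJ := (convexOn_exp).map_sum_le (t := (univ : Finset n)) (w := fun j => ex j * c j / Z)
    (p := fun j => -(a * (t j / c j))) hw0 hw1 (fun j _ => Set.mem_univ _)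
  simp only [smul_eq_mul] at hJ
  have hmean : ∑ j, ex j * c j / Z * (-(a * (t j / c j))) = -(a * ((∑ j, ex j * t j) / Z)) := by
    rw [Finset.sum_div, Finset.mul_sum, ← Finset.sum_neg_distrib]
    refine Finset.sum_congr rfl fun j _ => ?_
    calc ex j * c j / Z * (-(a * (t j / c j))) = -(a * (ex j * (c j * (t j / c j)) / Z)) := by ring
      _ = -(a * (ex j * t j / Z)) := by rw [hct]
  rw [hmean] at hJ
  have hZne : Z ≠ 0 := hZ.ne'
  calc Z * Real.exp (-(a * ((∑ j, ex j * t j) / Z)))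
      ≤ Z * ∑ j, ex j * c j / Z * Real.exp (-(a * (t j / c j))) :=
        mul_le_mul_of_nonneg_left hJ hZ.le
    _ = ∑ j, ex j * c j * Real.exp (-(a * (t j / c j))) := by
        rw [Finset.mul_sum]
        refine Finset.sum_congr rfl fun j _ => ?_
        field_simp
    _ ≤ ∑ j, ex j * g j := Finset.sum_le_sum fun j _ => hterm j

/-- **Thermal floor from the tilted bound.** With `Z = Re tr(e^{-βH}P) ≥ e^{-βE₀}` (some unit `ψ` with `Pψ = ψ`,
`Hψ = E₀ψ`) and the tilted bound `e^{βE₀ + a c} Re tr(e^{-βH} P e^{-aW} P) ≤ 1/2`: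
`log 2 + (βE₀ + log Z) ≤ a (M/Z − c)` — the configurational entropy `βE₀ + log Z ≥ 0` is an extra debit. [folklore] -/
theorem thermal_of_tilted_bound {H W P : Matrix n n ℂ} (hH : H.IsHermitian) (hW : W.IsHermitian)
    (hP : P.IsHermitian) (hPP : P * P = P) {ψ : n → ℂ} (hψ : star ψ ⬝ᵥ ψ = 1) (hPψ : P *ᵥ ψ = ψ)
    {β a E₀ c : ℝ} (hHψ : H *ᵥ ψ = ((E₀ : ℝ) : ℂ) • ψ)
    (hb : Real.exp (β * E₀ + a * c) * (gibbsWeight β H * (P * gibbsWeight a W * P)).trace.re ≤ 1 / 2) :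
    Real.exp (-(β * E₀)) ≤ (gibbsWeight β H * P).trace.re ∧
    0 ≤ β * E₀ + Real.log (gibbsWeight β H * P).trace.re ∧
    Real.log 2 + (β * E₀ + Real.log (gibbsWeight β H * P).trace.re) ≤
      a * ((gibbsWeight β H * (P * W * P)).trace.re / (gibbsWeight β H * P).trace.re - c) := by
  -- `Z ≥ ⟨ψ, e^{-βH} ψ⟩ = e^{-βE₀}`
  have hG : (gibbsWeight β H).PosSemidef := (posDef_gibbsWeight β hH).posSemidef
  have hPGP : (P * gibbsWeight β H * P).PosSemidef := by
    have h := hG.mul_mul_conjTranspose_same P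
    rwa [hP.eq] at h
  have hφP : star ψ ᵥ* P = star ψ := by
    rw [← hP.eq, ← star_mulVec, hPψ]
  have hq : star ψ ⬝ᵥ (P * gibbsWeight β H * P) *ᵥ ψ = ((Real.exp (-(β * E₀)) : ℝ) : ℂ) := by
    rw [← mulVec_mulVec, ← mulVec_mulVec, hPψ, dotProduct_mulVec, hφP,
      gibbsWeight_mulVec_of_eigenvector hH hHψ β, dotProduct_smul, hψ, smul_eq_mul, mul_one]
  have htrP : (P * gibbsWeight β H * P).trace = (gibbsWeight β H * P).trace := by
    rw [Matrix.trace_mul_cycle, hPP, Matrix.trace_mul_comm]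
  have hZlow : Real.exp (-(β * E₀)) ≤ (gibbsWeight β H * P).trace.re := by
    have h := re_rayleigh_le_re_trace_of_posSemidef hPGP hψ
    rw [hq, Complex.ofReal_re, htrP] at h
    exact h
  have hZ : 0 < (gibbsWeight β H * P).trace.re := (Real.exp_pos _).trans_le hZlow
  have hent : 0 ≤ β * E₀ + Real.log (gibbsWeight β H * P).trace.re := by
    have h := Real.log_le_log (Real.exp_pos _) hZlow
    rw [Real.log_exp] at h
    linarith
  refine ⟨hZlow, hent, ?_⟩
  set Z : ℝ := (gibbsWeight β H * P).trace.re with hZdef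
  set M : ℝ := (gibbsWeight β H * (P * W * P)).trace.re with hMdef
  have hmix := trace_mul_exp_le_re_trace_gibbs_sandwich hH hW hP hPP β a hZ
  have h2 : Real.exp (β * E₀ + a * c) * (Z * Real.exp (-(a * (M / Z)))) ≤ 1 / 2 :=
    (mul_le_mul_of_nonneg_left hmix (Real.exp_pos _).le).trans hb
  have h3 : Real.exp (β * E₀ + a * c + Real.log Z + -(a * (M / Z))) ≤ 1 / 2 := by
    rw [Real.exp_add, Real.exp_add, Real.exp_log hZ]
    calc Real.exp (β * E₀ + a * c) * Z * Real.exp (-(a * (M / Z)))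
        = Real.exp (β * E₀ + a * c) * (Z * Real.exp (-(a * (M / Z)))) := by ring
      _ ≤ 1 / 2 := h2
  have h4 : β * E₀ + a * c + Real.log Z + -(a * (M / Z)) ≤ Real.log (1 / 2) := by
    rw [Real.le_log_iff_exp_le (by norm_num : (0:ℝ) < 1 / 2)]
    exact h3
  have h5 : Real.log (1 / 2 : ℝ) = -Real.log 2 := by
    rw [one_div, Real.log_inv]
  rw [h5] at h4
  have : a * (M / Z - c) = a * (M / Z) - a * c := by ring
  linarith

end Abstract

/-! ## The crux in point form -/

/-- The sector projection `P_K` of `K = szSector N_L 0` (literally the route's `let P`). -/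
abbrev sectorProj (L : ℕ) (δ : ℝ) :
    Matrix (Finset (Orb (FermionTorus 2 L))) (Finset (Orb (FermionTorus 2 L))) ℂ :=
  projMatrix ((szSector (Λ := FermionTorus 2 L) (Nfill δ L) 0).map
    (Fock.toEuclidean (ι := Orb (FermionTorus 2 L)) :
      Fock (Orb (FermionTorus 2 L)) →ₗ[ℂ] EuclideanSpace ℂ (Finset (Orb (FermionTorus 2 L)))))

/-- The body of the crux at one datum `(U, δ, θ, ε, β, L, a)`:
`e^{βE₀ + aθL²} · Re tr(e^{-βH} · P e^{-aW_ε} P) ≤ 1/2`. -/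
def TwmBody (U δ θ ε β : ℝ) (L : ℕ) [NeZero L] (a : ℝ) : Prop :=
  Real.exp (β * (hubbardTorus 2 L 1 U).minEnergyOn (szSector (Λ := FermionTorus 2 L) (Nfill δ L) 0) +
      a * θ * (L : ℝ) ^ 2) *
    (Matrix.trace (gibbsWeight β (hubbardTorus 2 L 1 U) *
      (sectorProj L δ * gibbsWeight a (kacW L ε) * sectorProj L δ))).re ≤ 1 / 2

/-- The crux is, verbatim, `∃ (U,δ,θ,ε₁) ∀ ε ∃ β ∃ L₀ ∀ L ∃ a ≥ 0, TwmBody U δ θ ε β L a` (the route's `let`s are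
`pairFieldAt` / `kacW` / `sectorProj` by `rfl`). -/
theorem twm_iff : ThermalWindowMajorant ↔
    ∃ U : ℝ, 0 < U ∧ ∃ δ ∈ Set.Ioo (0:ℝ) (1 / 2), ∃ θ ε₁ : ℝ, 0 < θ ∧ 0 < ε₁ ∧
      ∀ ε ∈ Set.Ioc (0:ℝ) ε₁, ∃ β : ℝ, 0 < β ∧ ∃ L₀ : ℕ, ∀ (L : ℕ) [NeZero L], L₀ ≤ L → Even L →
        ∃ a : ℝ, 0 ≤ a ∧ TwmBody U δ θ ε β L a :=
  Iff.rfl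

/-! ## The three necessary consequences at a point -/

/-- **Every-ground-state window floor at a datum** (fixed `θ`, with the `log 2 / a` bonus). -/
def GroundFloorAt (U δ θ ε : ℝ) (L : ℕ) [NeZero L] (a : ℝ) : Prop :=
  ∀ ψ : Fock (Orb (FermionTorus 2 L)), star ψ ⬝ᵥ ψ = 1 →
    IsGroundStateInSector (hubbardTorus 2 L 1 U) (Nfill δ L) 0 ψ →
      θ * (L : ℝ) ^ 2 + Real.log 2 / a ≤ (star ψ ⬝ᵥ kacW L ε *ᵥ ψ).re

/-- **Eigenstate window gap at a datum**: every normalised sector eigenvector `Hφ = Eφ` has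
`log 2 ≤ β(E − E₀) + a(Re⟨φ,W_εφ⟩ − θL²)` (per-eigenstate form of KacWindowPenalty's `WindowGap`). -/
def EigenChernoffAt (U δ θ ε β : ℝ) (L : ℕ) [NeZero L] (a : ℝ) : Prop :=
  ∀ φ : Fock (Orb (FermionTorus 2 L)), φ ∈ szSector (Λ := FermionTorus 2 L) (Nfill δ L) 0 →
    star φ ⬝ᵥ φ = 1 → ∀ E : ℝ, hubbardTorus 2 L 1 U *ᵥ φ = ((E : ℝ) : ℂ) • φ →
      Real.log 2 ≤ β * (E - (hubbardTorus 2 L 1 U).minEnergyOn (szSector (Λ := FermionTorus 2 L) (Nfill δ L) 0)) +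
        a * ((star φ ⬝ᵥ kacW L ε *ᵥ φ).re - θ * (L : ℝ) ^ 2)

/-- **Thermal Kac-window floor at a datum**: with `Z_K = Re tr(e^{-βH}P_K)`, `⟨W_ε⟩_{β,K} = Re tr(e^{-βH} P_K W_ε P_K)/Z_K`:
`log 2 + (βE₀ + log Z_K) ≤ a(⟨W_ε⟩_{β,K} − θL²)` with `βE₀ + log Z_K ≥ 0`, hence `θL² + log 2 / a ≤ ⟨W_ε⟩_{β,K}` —
macroscopic `d`-wave window pair weight of the sector Gibbs state at the FIXED temperature `1/β`. -/
def ThermalFloorAt (U δ θ ε β : ℝ) (L : ℕ) [NeZero L] (a : ℝ) : Prop :=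
  let H := hubbardTorus 2 L 1 U
  let E₀ : ℝ := H.minEnergyOn (szSector (Λ := FermionTorus 2 L) (Nfill δ L) 0)
  let Z : ℝ := (Matrix.trace (gibbsWeight β H * sectorProj L δ)).re
  let M : ℝ := (Matrix.trace (gibbsWeight β H * (sectorProj L δ * kacW L ε * sectorProj L δ))).re
  Real.exp (-(β * E₀)) ≤ Z ∧ 0 ≤ β * E₀ + Real.log Z ∧
  Real.log 2 + (β * E₀ + Real.log Z) ≤ a * (M / Z - θ * (L : ℝ) ^ 2) ∧
  θ * (L : ℝ) ^ 2 + Real.log 2 / a ≤ M / Z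

/-- The Kac window operator is Hermitian (a real combination of `DᴴD`'s). [folklore] -/
theorem kacW_isHermitian (L : ℕ) [NeZero L] (ε : ℝ) : (kacW L ε).IsHermitian := by
  refine (isSelfAdjoint_sum Finset.univ fun m _ => ?_).isHermitian
  split_ifs
  · refine ((Matrix.isHermitian_conjTranspose_mul_self _).smul ?_).isSelfAdjoint
    rw [IsSelfAdjoint, ← Complex.ofReal_natCast, ← Complex.ofReal_pow, ← Complex.ofReal_inv,
      Complex.star_def, Complex.conj_ofReal]
  · exact IsSelfAdjoint.zero _

/-- **THE COSTUME THEOREM AT A POINT.** The crux body at one datum with `a ≥ 0` forces `a > 0` together with the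
every-ground-state window floor, the eigenstate window gap and the thermal window floor at the same datum. [folklore] -/
theorem pointConsequences_of_twmBody {U δ θ ε β : ℝ} {L : ℕ} [NeZero L] {a : ℝ} (hδ : -1 ≤ δ)
    (ha : 0 ≤ a) (hb : TwmBody U δ θ ε β L a) :
    0 < a ∧ GroundFloorAt U δ θ ε L a ∧ EigenChernoffAt U δ θ ε β L a ∧ ThermalFloorAt U δ θ ε β L a := by
  have hH : (hubbardTorus 2 L 1 U).IsHermitian :=
    LiebThm1.hamiltonian_isHermitian (fermionTorusGraph 2 L) 1 U
  have hW : (kacW L ε).IsHermitian := kacW_isHermitian L ε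
  have hP : (sectorProj L δ).IsHermitian := projMatrix_isHermitian _
  have hPP : sectorProj L δ * sectorProj L δ = sectorProj L δ := projMatrix_mul_self _
  have hPmem : ∀ φ : Fock (Orb (FermionTorus 2 L)),
      φ ∈ szSector (Λ := FermionTorus 2 L) (Nfill δ L) 0 → sectorProj L δ *ᵥ φ = φ :=
    fun φ hφ => projMatrix_map_mulVec_of_mem _ hφ
  have hb' : Real.exp (β * (hubbardTorus 2 L 1 U).minEnergyOn
        (szSector (Λ := FermionTorus 2 L) (Nfill δ L) 0) + a * (θ * (L : ℝ) ^ 2)) *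
      (gibbsWeight β (hubbardTorus 2 L 1 U) *
        (sectorProj L δ * gibbsWeight a (kacW L ε) * sectorProj L δ)).trace.re ≤ 1 / 2 := by
    have h := hb
    unfold TwmBody at h
    rwa [mul_assoc a θ] at h
  -- a ground state exists
  obtain ⟨ψ₀, hψ₀, hgs₀⟩ :=
    exists_unit_isGroundStateInSector_hubbardTorus U L _ (natFloor_filling_le_sq hδ L)
  -- Chernoff for eigenvectors
  have hchern : EigenChernoffAt U δ θ ε β L a := fun φ hφS hφ E hHφ =>
    chernoff_of_tilted_bound hH hW hP hφ (hPmem φ hφS) hHφ hb'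
  -- the ground case
  have hground : ∀ ψ : Fock (Orb (FermionTorus 2 L)), star ψ ⬝ᵥ ψ = 1 →
      IsGroundStateInSector (hubbardTorus 2 L 1 U) (Nfill δ L) 0 ψ →
        0 < a ∧ θ * (L : ℝ) ^ 2 + Real.log 2 / a ≤ (star ψ ⬝ᵥ kacW L ε *ᵥ ψ).re := by
    intro ψ hψ hgs
    have h := hchern ψ hgs.1 hψ _ hgs.2.2
    simp only [sub_self, mul_zero, zero_add] at h
    exact ⟨(floor_of_chernoff ha h).1, (floor_of_chernoff ha h).2.1⟩
  have ha' : 0 < a := (hground ψ₀ hψ₀ hgs₀).1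
  have hth := thermal_of_tilted_bound hH hW hP hPP hψ₀ (hPmem ψ₀ hgs₀.1) hgs₀.2.2 hb'
  refine ⟨ha', fun ψ hψ hgs => (hground ψ hψ hgs).2, hchern, ?_⟩
  have hmz := le_trans (le_add_of_nonneg_right hth.2.1) hth.2.2
  unfold ThermalFloorAt
  exact ⟨hth.1, hth.2.1, hth.2.2, (floor_of_chernoff ha'.le hmz).2.1⟩

/-! ## Global consequences of the crux -/

/-- **Every ground state has Kac-window pair weight `> θL²` at fixed `θ` for every window radius.** -/
def EveryGSWindowFloor : Prop :=
  ∃ U : ℝ, 0 < U ∧ ∃ δ ∈ Set.Ioo (0:ℝ) (1 / 2), ∃ θ ε₁ : ℝ, 0 < θ ∧ 0 < ε₁ ∧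
    ∀ ε ∈ Set.Ioc (0:ℝ) ε₁, ∃ L₀ : ℕ, ∀ (L : ℕ) [NeZero L], L₀ ≤ L → Even L →
      ∀ ψ : Fock (Orb (FermionTorus 2 L)), star ψ ⬝ᵥ ψ = 1 →
        IsGroundStateInSector (hubbardTorus 2 L 1 U) (Nfill δ L) 0 ψ →
          θ * (L : ℝ) ^ 2 < (star ψ ⬝ᵥ kacW L ε *ᵥ ψ).re

/-- **Positive-temperature `d`-wave Kac-window quasi-order of the 2D Hubbard torus**: at some `(U, δ)`, for every
window radius `ε` there is a FIXED inverse temperature `β(ε)` at which the sector Gibbs state has window pair weight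
`θL² · Z_K < Re tr(e^{-βH} P_K W_ε P_K)` eventually in even `L` — the thermal statement any proof of the crux must
contain (refuter ATTACK (ii)); no reflection-positivity-free engine is known (census §Transfer). -/
def ThermalWindowQuasiOrder : Prop :=
  ∃ U : ℝ, 0 < U ∧ ∃ δ ∈ Set.Ioo (0:ℝ) (1 / 2), ∃ θ ε₁ : ℝ, 0 < θ ∧ 0 < ε₁ ∧
    ∀ ε ∈ Set.Ioc (0:ℝ) ε₁, ∃ β : ℝ, 0 < β ∧ ∃ L₀ : ℕ, ∀ (L : ℕ) [NeZero L], L₀ ≤ L → Even L →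
      θ * (L : ℝ) ^ 2 * (Matrix.trace (gibbsWeight β (hubbardTorus 2 L 1 U) * sectorProj L δ)).re <
        (Matrix.trace (gibbsWeight β (hubbardTorus 2 L 1 U) *
          (sectorProj L δ * kacW L ε * sectorProj L δ))).re

/-- `ThermalWindowMajorant → EveryGSWindowFloor`. [folklore] -/
theorem everyGSWindowFloor_of_twm (h : ThermalWindowMajorant) : EveryGSWindowFloor := by
  obtain ⟨U, hU, δ, hδ, θ, ε₁, hθ, hε₁, hmain⟩ := (twm_iff).1 h
  refine ⟨U, hU, δ, hδ, θ, ε₁, hθ, hε₁, fun ε hε => ?_⟩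
  obtain ⟨β, hβ, L₀, hL⟩ := hmain ε hε
  refine ⟨L₀, fun L _ hL₀ hE ψ hψ hgs => ?_⟩
  obtain ⟨a, ha, hb⟩ := hL L hL₀ hE
  have hc := pointConsequences_of_twmBody (by linarith [hδ.1]) ha hb
  have hfl := hc.2.1 ψ hψ hgs
  have : 0 < Real.log 2 / a := div_pos (Real.log_pos (by norm_num)) hc.1
  linarith

/-- `ThermalWindowMajorant → ThermalWindowQuasiOrder`. [folklore] -/
theorem thermalWindowQuasiOrder_of_twm (h : ThermalWindowMajorant) : ThermalWindowQuasiOrder := by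
  obtain ⟨U, hU, δ, hδ, θ, ε₁, hθ, hε₁, hmain⟩ := (twm_iff).1 h
  refine ⟨U, hU, δ, hδ, θ, ε₁, hθ, hε₁, fun ε hε => ?_⟩
  obtain ⟨β, hβ, L₀, hL⟩ := hmain ε hε
  refine ⟨β, hβ, L₀, fun L _ hL₀ hE => ?_⟩
  obtain ⟨a, ha, hb⟩ := hL L hL₀ hE
  have hc := pointConsequences_of_twmBody (by linarith [hδ.1]) ha hb
  obtain ⟨hZlow, -, -, hfloor⟩ := hc.2.2.2
  set Z : ℝ := (Matrix.trace (gibbsWeight β (hubbardTorus 2 L 1 U) * sectorProj L δ)).re with hZdef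
  set M : ℝ := (Matrix.trace (gibbsWeight β (hubbardTorus 2 L 1 U) *
    (sectorProj L δ * kacW L ε * sectorProj L δ))).re with hMdef
  have hZ : 0 < Z := (Real.exp_pos _).trans_le hZlow
  have hpos : 0 < Real.log 2 / a := div_pos (Real.log_pos (by norm_num)) hc.1
  have hlt : θ * (L : ℝ) ^ 2 < M / Z := by linarith
  rwa [lt_div_iff₀ hZ] at hlt

/-! ## Joining the sibling census: what the route consumes of this crux is the summit at the point -/

/-- **Crux body at a point ⇒ `FloorAt U δ`** (KacWindowPenalty census D7's every-GS window floor). [folklore] -/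
theorem floorAt_of_twm_point {U δ θ ε₁ : ℝ} (hδ : -1 ≤ δ) (hθ : 0 < θ) (hε₁ : 0 < ε₁)
    (h : ∀ ε ∈ Set.Ioc (0:ℝ) ε₁, ∃ β : ℝ, 0 < β ∧ ∃ L₀ : ℕ, ∀ (L : ℕ) [NeZero L], L₀ ≤ L → Even L →
      ∃ a : ℝ, 0 ≤ a ∧ TwmBody U δ θ ε β L a) :
    FloorAt U δ := by
  intro C hC ε₀ hε₀
  have hden : (0 : ℝ) < 2 * C + 1 := by linarith
  have hq : 0 < θ / (2 * C + 1) := div_pos hθ hden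
  set ε : ℝ := min ε₀ (min ε₁ (θ / (2 * C + 1))) with hεdef
  have hεpos : 0 < ε := lt_min hε₀ (lt_min hε₁ hq)
  have hεε₀ : ε ≤ ε₀ := min_le_left _ _
  have hεε₁ : ε ≤ ε₁ := (min_le_right _ _).trans (min_le_left _ _)
  have hεq : ε ≤ θ / (2 * C + 1) := (min_le_right _ _).trans (min_le_right _ _)
  have hCε : C * ε ≤ θ / 2 := by
    have h1 : C * ε ≤ C * (θ / (2 * C + 1)) := mul_le_mul_of_nonneg_left hεq hC
    have h2 : C * (θ / (2 * C + 1)) ≤ θ / 2 := by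
      rw [mul_div_assoc', div_le_div_iff₀ hden two_pos]
      nlinarith
    linarith
  obtain ⟨β, hβ, L₀, hL⟩ := h ε ⟨hεpos, hεε₁⟩
  refine ⟨ε, ⟨hεpos, hεε₀⟩, θ / 2, half_pos hθ, L₀, fun L _ hL₀ hE ψ hψ1 hψ => ?_⟩
  obtain ⟨a, ha, hb⟩ := hL L hL₀ hE
  have hc := pointConsequences_of_twmBody hδ ha hb
  have hfl := hc.2.1 ψ hψ1 hψ
  have hpos : 0 < Real.log 2 / a := div_pos (Real.log_pos (by norm_num)) hc.1
  have hL2 : (0 : ℝ) ≤ (L : ℝ) ^ 2 := by positivity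
  have h2 : (C * ε + θ / 2) * (L : ℝ) ^ 2 ≤ θ * (L : ℝ) ^ 2 :=
    mul_le_mul_of_nonneg_right (by linarith) hL2
  linarith

/-- `ThermalWindowMajorant → WindowFloor` (the sibling census's `wuc` form of `WindowGap`). [folklore] -/
theorem windowFloor_of_twm (h : ThermalWindowMajorant) : WindowFloor := by
  obtain ⟨U, hU, δ, hδ, θ, ε₁, hθ, hε₁, hmain⟩ := (twm_iff).1 h
  exact ⟨U, hU, δ, hδ, floorAt_of_twm_point (by linarith [hδ.1]) hθ hε₁ hmain⟩

/-- The route's crux 3 IS KacWindowPenalty's crux 3 (shared item stmt-1089). -/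
theorem windowInfraredBound_iff_kac :
    WindowInfraredBound ↔
      Summit.HubbardSuperconductivity.HubbardSuperconductivity.Theses.KacWindowPenalty.WindowInfraredBound :=
  Iff.rfl

/-- **The route closes from the crux and crux 3 alone** — no `FloorOfCruxes`, `MajorantTransfer`,
`UniformLROGivesSummitMatrix`: `ThermalWindowMajorant → WindowInfraredBound → HubbardSuperconductivity`. [folklore] -/
theorem hubbardSuperconductivity_of_twm_of_wib (h1 : ThermalWindowMajorant) (h2 : WindowInfraredBound) :
    _root_.HubbardSuperconductivity :=
  hubbardSuperconductivity_of_windowFloor_of_wib (windowFloor_of_twm h1) ((windowInfraredBound_iff_kac).1 h2)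

/-- **Given crux 3 at the point, what the route consumes of the crux is the summit's matrix at `(U, δ)`.**
(`floorAt_of_twm_point` + the sibling census's `floorAt_iff_summitMatrix_of_wibAt`.) [folklore] -/
theorem summitMatrix_of_twm_point_of_wibAt {U δ θ ε₁ : ℝ} (hδ : -1 ≤ δ) (hθ : 0 < θ) (hε₁ : 0 < ε₁)
    (hW : WibAt U δ)
    (h : ∀ ε ∈ Set.Ioc (0:ℝ) ε₁, ∃ β : ℝ, 0 < β ∧ ∃ L₀ : ℕ, ∀ (L : ℕ) [NeZero L], L₀ ≤ L → Even L →
      ∃ a : ℝ, 0 ≤ a ∧ TwmBody U δ θ ε β L a) :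
    ∀ (N : ℕ → ℕ) (ψ : ∀ L, Fock (Orb (FermionTorus 2 L))),
      (∀ L, Even L → N L = 2 * ⌊(1 - δ) * (L : ℝ) ^ 2 / 2⌋₊ ∧ star (ψ L) ⬝ᵥ ψ L = 1 ∧
          IsGroundStateInSector (hubbardTorus 2 L 1 U) (N L) 0 (ψ L)) →
        Literature.Probability.LatticeModels.HasLongRangeOrder
          (fun k => Literature.Probability.LatticeModels.halfOpenBox 2 (2 * k))
          (fun k => torusPullback (pairFieldCorr dWaveFormFactor ψ) (2 * k)) :=
  (floorAt_iff_summitMatrix_of_wibAt hδ hW).1 (floorAt_of_twm_point hδ hθ hε₁ h)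

/-! ## Typed strategist attempts (census §Strengthen / §Decomposition); not filed -/

/-- **D-r1.1 (decomposition by MOMENT vs TAIL), piece A** — the thermal first moment: Kac-window quasi-order with
room `3θ`. Open; = positive-temperature superconducting quasi-order of the 2D Hubbard model (no RP-free engine). -/
def ThermalWindowFloor3 (U δ θ ε β : ℝ) (L : ℕ) [NeZero L] : Prop :=
  3 * θ * (L : ℝ) ^ 2 * (Matrix.trace (gibbsWeight β (hubbardTorus 2 L 1 U) * sectorProj L δ)).re ≤
    (Matrix.trace (gibbsWeight β (hubbardTorus 2 L 1 U) * (sectorProj L δ * kacW L ε * sectorProj L δ))).re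

/-- **D-r1.1, piece B** — lower-tail large deviation of the window weight in the sector Gibbs state at a rate beating
the configurational entropy: the thermal weight of the spectral event `{W_ε ≤ 2θL²}` is at most
`e^{-2(βE₀ + log Z_K)}/16`. Typed through the bridge form `A → TwmBody` to keep the glue elementary (the spectral
form needs the functional calculus of `W_ε`); open, no engine below the pairing scale (quantum LD theory is
high-temperature / one-dimensional). -/
def WindowConcentrationBridge (U δ θ ε β : ℝ) (L : ℕ) [NeZero L] : Prop :=
  ThermalWindowFloor3 U δ θ ε β L → ∃ a : ℝ, 0 ≤ a ∧ TwmBody U δ θ ε β L a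

/-- Glue of D-r1.1 (modus ponens; `trivial_seam`). Not filed: piece A is the `T > 0` sibling of the summit and
piece B is the crux given A — neither has a plan (census §Decomposition). [folklore] -/
theorem twmBody_of_split {U δ θ ε β : ℝ} {L : ℕ} [NeZero L]
    (hA : ThermalWindowFloor3 U δ θ ε β L) (hB : WindowConcentrationBridge U δ θ ε β L) :
    ∃ a : ℝ, 0 ≤ a ∧ TwmBody U δ θ ε β L a :=
  hB hA

end Summit.HubbardSuperconductivity.HubbardSuperconductivity.Cruxes.ThermalWindowMajorant.StrategistR1

end
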